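import Mathlib
import Summits.Ventures.PercRepro2.HCov
import Summits.Ventures.PercRepro2.BHKAvoid
import Summits.Ventures.PercRepro2.ISplit
import Summits.Ventures.PercRepro2.FirstOrderTerms

/-!
# The open piece `D(β, γ) ≥ 0` of the degree-one-root contraction reduces to a covariance-mass
# monotonicity `Κ_R ≥ Κ_PD` (blind cell PercRepro2, p5 g23; `proofs/P5-OEDGE.md` §29, `S4-HARDSTEP.md` v97)

With `R = {a₁ ↮ a₂, a₃} = PD ⊔ T` (`ISplit.prob_PD_add_T`), `L_x = 1[x ∈ C₁]`, the masses
`t = P(T)`, `D = P(PD)`, `t_x = P(T, L_x)`, `t_bo = P(T, L_b, L_o)`, `p_x = P(PD, L_x)`, the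
unconditioned `β = P(b ↔ a₁)` and `D_o = P(PD, o ∈ C₁ ∪ C₂)`, the D-part of the mixed corner of the
bilinear form, cleared by `D`, is

  `Dmix := D·t_bo − β·D·t_o − D_o·t_b + β·D_o·t`  (`= D · E[(L_b − β)(L_o − γ); T]`, `γ = D_o/D`).

`Dmix` is affine in `β` with slope `t·D_o − D·t_o ≥ 0` and affine in `D_o` with slope `β·t − t_b ≥ 0`,
so lowering `β` to `P(b ∈ C₁ | R)` and `D_o` to `p_o = P(PD, o ∈ C₁)` can only decrease it; at those
values it becomes, cleared by `P(R) = D + t`,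

  `Theta := t·p_b·p_o + D·(D + t)·t_bo − D·(p_b·t_o + t_b·p_o + t_b·t_o)`
  (`= t·D·(D + t) · [D(β_R, γ_L)/t] = D·(D + t) · (Κ_R − Κ_PD)`, `Κ_A := P(A)·Cov(L_b, L_o | A)`),

the statement that conditioning `R` further on the disconnection `a₂ ↮ a₃` can only lower the
covariance mass of the two inside events `b ∈ C₁`, `o ∈ C₁`. The four facts used:
`P(R, b ∈ C₁) ≤ β·P(R)` (Harris, mixed), `P(PD, o ∈ C₁) ≤ D_o` (monotonicity), and
`P(T, x ∈ C₁)·P(R) ≤ P(R, x ∈ C₁)·P(T)` for `x = b, o` (`bhk_cross_cluster_avoid`, `s = a₁`,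
`t = a₂`, `X = {a₂, a₃}`: on `R` the inside event `x ∈ C₁` and the outside event `a₃ ∈ C₂` are
negatively correlated). Main theorem: `Dmix_nonneg_of_Theta : 0 ≤ Theta → 0 ≤ Dmix`.
-/

namespace Summit.Ventures.PercRepro2

open UnionCluster

namespace CovForm

namespace FirstOrder

section Sets

variable {V : Type*} {E : Type*} [Fintype E] [DecidableEq E] [Fintype V] [DecidableEq V]

omit [Fintype E] [DecidableEq E] [Fintype V] [DecidableEq V] in
/-- `avoidAll ends a₁ X` is a down-set. -/
lemma isLowerSet_avoidAll (ends : E → Sym2 V) (a₁ : V) (X : Finset V) :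
    IsLowerSet (avoidAll ends a₁ X) := by
  intro ω ω' h hω y hy hc
  exact hω y hy (conn_mono h hc)

omit [Fintype E] [DecidableEq E] [Fintype V] in
/-- `T = {a₃ ∈ C₂} ∩ R` (the outside event of `bhk_cross_cluster_avoid`). -/
lemma clusterIn_a2_a3_inter_R_eq_T (ends : E → Sym2 V) (a₁ a₂ a₃ : V) :
    clusterInEvent ends a₂ {W | a₃ ∈ W} ∩ avoidAll ends a₁ {a₂, a₃} = TEvent ends a₁ a₂ a₃ := by
  rw [ISplit.T_eq_R_inter, ← connEvent_eq_clusterInEvent, Set.inter_comm]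

omit [Fintype E] [DecidableEq E] [Fintype V] in
/-- `{x ∈ C₁} ∩ {a₃ ∈ C₂} ∩ R = T ∩ {x ∈ C₁}`. -/
lemma clusterIn_x_a3_inter_R_eq_T_inter (ends : E → Sym2 V) (a₁ a₂ a₃ x : V) :
    clusterInEvent ends a₁ {W | x ∈ W} ∩ clusterInEvent ends a₂ {W | a₃ ∈ W} ∩
        avoidAll ends a₁ {a₂, a₃} = TEvent ends a₁ a₂ a₃ ∩ connEvent ends a₁ x := by
  rw [Set.inter_assoc, clusterIn_a2_a3_inter_R_eq_T, ← connEvent_eq_clusterInEvent, Set.inter_comm]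

end Sets

section Main

variable {V : Type*} {E : Type*} [Fintype E] [DecidableEq E] [Fintype V] [DecidableEq V]
  {R : Type*} [Field R] [LinearOrder R] [IsStrictOrderedRing R]

/-- `Dmix = D·P(T, bL, oL) − β·D·P(T, oL) − D_o·P(T, bL) + β·D_o·P(T)` — the D-part of the mixed
corner `Ψ(β, γ)`, cleared by `D` (`= D · E[(L_b − β)(L_o − γ); T]`). -/
noncomputable def Dmix (p : E → R) (ends : E → Sym2 V) (o a₁ a₂ a₃ b : V) : R :=
  prob p (PDEvent ends a₁ a₂ a₃) *
      prob p (TEvent ends a₁ a₂ a₃ ∩ connEvent ends a₁ b ∩ connEvent ends a₁ o) -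
    beta p ends a₁ b * prob p (PDEvent ends a₁ a₂ a₃) *
      prob p (TEvent ends a₁ a₂ a₃ ∩ connEvent ends a₁ o) -
    Do p ends o a₁ a₂ a₃ * prob p (TEvent ends a₁ a₂ a₃ ∩ connEvent ends a₁ b) +
    beta p ends a₁ b * Do p ends o a₁ a₂ a₃ * prob p (TEvent ends a₁ a₂ a₃)

/-- `Theta = t·p_b·p_o + D·(D + t)·t_bo − D·(p_b·t_o + t_b·p_o + t_b·t_o)`: the covariance-mass
monotonicity `Κ_R ≥ Κ_PD` for the inside events `b ∈ C₁`, `o ∈ C₁`, cleared by `D·P(R)`. -/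
noncomputable def Theta (p : E → R) (ends : E → Sym2 V) (o a₁ a₂ a₃ b : V) : R :=
  prob p (TEvent ends a₁ a₂ a₃) * prob p (PDEvent ends a₁ a₂ a₃ ∩ connEvent ends a₁ b) *
      prob p (PDEvent ends a₁ a₂ a₃ ∩ connEvent ends a₁ o) +
    prob p (PDEvent ends a₁ a₂ a₃) * (prob p (PDEvent ends a₁ a₂ a₃) + prob p (TEvent ends a₁ a₂ a₃)) *
      prob p (TEvent ends a₁ a₂ a₃ ∩ connEvent ends a₁ b ∩ connEvent ends a₁ o) -
    prob p (PDEvent ends a₁ a₂ a₃) *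
      (prob p (PDEvent ends a₁ a₂ a₃ ∩ connEvent ends a₁ b) *
          prob p (TEvent ends a₁ a₂ a₃ ∩ connEvent ends a₁ o) +
        prob p (TEvent ends a₁ a₂ a₃ ∩ connEvent ends a₁ b) *
          prob p (PDEvent ends a₁ a₂ a₃ ∩ connEvent ends a₁ o) +
        prob p (TEvent ends a₁ a₂ a₃ ∩ connEvent ends a₁ b) *
          prob p (TEvent ends a₁ a₂ a₃ ∩ connEvent ends a₁ o))

/-- **`P(T, x ∈ C₁) · P(R) ≤ P(R, x ∈ C₁) · P(T)`**: on `R = {a₁ ↮ a₂, a₃}` the inside event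
`x ∈ C₁` and the outside event `a₃ ∈ C₂` are negatively correlated (`bhk_cross_cluster_avoid`). -/
theorem T_xL_mul_R_le (p : E → R) (hp : IsProbVec p) (ends : E → Sym2 V) (a₁ a₂ a₃ x : V) :
    prob p (TEvent ends a₁ a₂ a₃ ∩ connEvent ends a₁ x) * prob p (avoidAll ends a₁ {a₂, a₃}) ≤
      prob p (avoidAll ends a₁ {a₂, a₃} ∩ connEvent ends a₁ x) * prob p (TEvent ends a₁ a₂ a₃) := by
  classical
  have h := bhk_cross_cluster_avoid p hp ends a₁ a₂ (X := ({a₂, a₃} : Finset V))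
    (Finset.mem_insert_self a₂ {a₃}) (isUpperSet_mem_setOf x) (isUpperSet_mem_setOf a₃)
  rw [clusterIn_x_a3_inter_R_eq_T_inter, clusterIn_a2_a3_inter_R_eq_T,
    ← connEvent_eq_clusterInEvent, Set.inter_comm (connEvent ends a₁ x)] at h
  exact h

omit [Fintype V] in
/-- **`P(R, b ∈ C₁) ≤ β · P(R)`** (Harris: `R` decreasing, `b ∈ C₁` increasing). -/
theorem R_bL_le_beta_mul (p : E → R) (hp : IsProbVec p) (ends : E → Sym2 V) (a₁ a₂ a₃ b : V) :
    prob p (avoidAll ends a₁ {a₂, a₃} ∩ connEvent ends a₁ b) ≤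
      prob p (avoidAll ends a₁ {a₂, a₃}) * beta p ends a₁ b :=
  prob_inter_le_prob_mul_prob_of_isLowerSet hp (isLowerSet_avoidAll ends a₁ {a₂, a₃})
    (isUpperSet_connEvent ends a₁ b)

omit [Fintype V] [DecidableEq V] in
/-- `P(PD, o ∈ C₁) ≤ D_o = P(PD, o ∈ C₁ ∪ C₂)`. -/
theorem PD_oL_le_Do (p : E → R) (hp : IsProbVec p) (ends : E → Sym2 V) (o a₁ a₂ a₃ : V) :
    prob p (PDEvent ends a₁ a₂ a₃ ∩ connEvent ends a₁ o) ≤ Do p ends o a₁ a₂ a₃ := by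
  unfold Do
  linarith [prob_nonneg hp (PDEvent ends a₁ a₂ a₃ ∩ connEvent ends a₂ o)]

omit [Fintype E] [DecidableEq E] [Fintype V] [DecidableEq V] in
/-- The algebra of the two substitutions, over abstract masses: with `X = t·D_o − D·t_o ≥ 0` and
`Y = t·p_b − D·t_b ≥ 0`, `(D + t)·Dmix − Theta = ((D + t)·β − (t_b + p_b))·X + (D_o − p_o)·Y`. -/
lemma theta_le_aux {t D tb t_o tbo pb po β Dₒ : R} (h0t : 0 ≤ t)
    (f1 : tb + pb ≤ (D + t) * β) (s1 : D * t_o ≤ t * po) (s2 : D * tb ≤ t * pb) (f4 : po ≤ Dₒ) :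
    t * pb * po + D * (D + t) * tbo - D * (pb * t_o + tb * po + tb * t_o) ≤
      (D + t) * (D * tbo - β * D * t_o - Dₒ * tb + β * Dₒ * t) := by
  have hX : 0 ≤ t * Dₒ - D * t_o := by nlinarith [mul_le_mul_of_nonneg_left f4 h0t]
  have hY : 0 ≤ t * pb - D * tb := by linarith
  have e1 : (tb + pb) * (t * Dₒ - D * t_o) ≤ (D + t) * β * (t * Dₒ - D * t_o) :=
    mul_le_mul_of_nonneg_right f1 hX
  have e2 : po * (t * pb - D * tb) ≤ Dₒ * (t * pb - D * tb) := mul_le_mul_of_nonneg_right f4 hY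
  linear_combination e1 + e2

/-- **`Theta ≤ (D + t) · Dmix`**: lowering `β` to `P(b ∈ C₁ | R)` and `D_o` to `P(PD, o ∈ C₁)`
along the two nonnegative slopes of `Dmix` lands exactly on `Theta / P(R)`. -/
theorem Theta_le_R_mul_Dmix (p : E → R) (hp : IsProbVec p) (ends : E → Sym2 V)
    (o a₁ a₂ a₃ b : V) :
    Theta p ends o a₁ a₂ a₃ b ≤
      (prob p (PDEvent ends a₁ a₂ a₃) + prob p (TEvent ends a₁ a₂ a₃)) * Dmix p ends o a₁ a₂ a₃ b := by
  classical
  -- `R = PD ⊔ T` on the three events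
  have hR := ISplit.prob_PD_add_T p ends a₁ a₂ a₃ Set.univ
  simp only [Set.inter_univ] at hR
  have hRb := ISplit.prob_PD_add_T p ends a₁ a₂ a₃ (connEvent ends a₁ b)
  have hRo := ISplit.prob_PD_add_T p ends a₁ a₂ a₃ (connEvent ends a₁ o)
  -- the four facts
  have f1 := R_bL_le_beta_mul p hp ends a₁ a₂ a₃ b
  have f2 := T_xL_mul_R_le p hp ends a₁ a₂ a₃ b
  have f3 := T_xL_mul_R_le p hp ends a₁ a₂ a₃ o
  have f4 := PD_oL_le_Do p hp ends o a₁ a₂ a₃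
  rw [← hR, ← hRb] at f1 f2
  rw [← hR, ← hRo] at f3
  have h0t : 0 ≤ prob p (TEvent ends a₁ a₂ a₃) := prob_nonneg hp _
  -- the two slope facts, cleared: `D·t_o ≤ t·p_o` and `D·t_b ≤ t·p_b`
  have s1 : prob p (PDEvent ends a₁ a₂ a₃) * prob p (TEvent ends a₁ a₂ a₃ ∩ connEvent ends a₁ o) ≤
      prob p (TEvent ends a₁ a₂ a₃) * prob p (PDEvent ends a₁ a₂ a₃ ∩ connEvent ends a₁ o) := by
    linarith [f3]
  have s2 : prob p (PDEvent ends a₁ a₂ a₃) * prob p (TEvent ends a₁ a₂ a₃ ∩ connEvent ends a₁ b) ≤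
      prob p (TEvent ends a₁ a₂ a₃) * prob p (PDEvent ends a₁ a₂ a₃ ∩ connEvent ends a₁ b) := by
    linarith [f2]
  have f1' : prob p (TEvent ends a₁ a₂ a₃ ∩ connEvent ends a₁ b) +
      prob p (PDEvent ends a₁ a₂ a₃ ∩ connEvent ends a₁ b) ≤
      (prob p (PDEvent ends a₁ a₂ a₃) + prob p (TEvent ends a₁ a₂ a₃)) * beta p ends a₁ b := by
    linarith [f1]
  unfold Theta Dmix
  exact theta_le_aux h0t f1' s1 s2 f4

/-- **The open piece of the degree-one-root contraction, conditional on `Theta ≥ 0`**: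
`0 ≤ Theta → 0 ≤ Dmix`, i.e. `D(β, γ) ≥ 0` on the instance. -/
theorem Dmix_nonneg_of_Theta (p : E → R) (hp : IsProbVec p) (ends : E → Sym2 V) (o a₁ a₂ a₃ b : V)
    (hΘ : 0 ≤ Theta p ends o a₁ a₂ a₃ b) : 0 ≤ Dmix p ends o a₁ a₂ a₃ b := by
  classical
  have h := Theta_le_R_mul_Dmix p hp ends o a₁ a₂ a₃ b
  have h0D : 0 ≤ prob p (PDEvent ends a₁ a₂ a₃) := prob_nonneg hp _
  have h0t : 0 ≤ prob p (TEvent ends a₁ a₂ a₃) := prob_nonneg hp _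
  rcases eq_or_lt_of_le (add_nonneg h0D h0t) with hZ | hZ
  · -- degenerate: `D = t = 0`, every mass vanishes and `Dmix = 0`
    have hD : prob p (PDEvent ends a₁ a₂ a₃) = 0 := by linarith
    have ht : prob p (TEvent ends a₁ a₂ a₃) = 0 := by linarith
    have htb : prob p (TEvent ends a₁ a₂ a₃ ∩ connEvent ends a₁ b) = 0 :=
      le_antisymm (ht ▸ prob_inter_le_left hp _ _) (prob_nonneg hp _)
    unfold Dmix
    rw [hD, ht, htb]
    ring_nf
    exact le_refl _
  · exact nonneg_of_mul_nonneg_right (hΘ.trans h) hZ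

end Main

end FirstOrder

end CovForm

end Summit.Ventures.PercRepro2
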